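import Literature.Analysis.FluidPDE.PassiveScalarDiagMildSourceDuhamel
import HarnessLib

/-!
# Mild (Duhamel) formulation of the passive scalar equation with constant diagonal diffusion and
  bounded drift: the free term of the FORCED mild equation

Analysis/FluidPDE proof-support file (everything proved). The damped free term of the mild
(Duhamel) equation of the forced problem `∂ₜθ + div(uθ) = κ∑ᵢaᵢ∂ᵢ∂ᵢθ + s` after the substitution
`θ = e^{λt}w`:
`f(t)(k) = e^{-(νₖ+λ)t} θ̂₀(k) + ∫_{(0,t]} e^{-(νₖ+λ)(t-τ)} e^{-λτ} ŝ(τ)(k) dτ` (`Torus.forcedFreeTerm` =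
`Torus.heatFamily` + `Torus.sourceDuhamel` of the attenuated source), i.e. the Fourier side of
`e^{-λt}(e^{tA}θ₀ + ∫₀ᵗ e^{(t-τ)A}s(τ)dτ)`, `A = κ∑ᵢaᵢ∂ᵢ∂ᵢ` (Pazy 1983, Ch. 4 Cor. 2.5). Proved: the
heat family and the free term are admissible coefficient families (`Torus.IsMildCoeff`, bounds
`‖θ₀‖_{L²}` and `‖θ₀‖_{L²} + √(E_s/(2λ))`), sums of admissible families are admissible, the undamping
identity `e^{λt}f(t)(k) = e^{-νₖt}θ̂₀(k) + S⁰(s)(t)(k)`, and the contraction condition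
`(∑ⱼaⱼ⁻¹)U²/(2κλ) ≤ 1/4` for `λ = 2(∑ⱼaⱼ⁻¹)U²/κ + 1` — the inputs of the Picard iteration
`PassiveScalarDiagMildPicard` for the forced problem (`PassiveScalarDiagForcedExistence`).

## References

* A. Pazy, *Semigroups of Linear Operators and Applications to PDE*, Springer 1983, Ch. 4 §4.2,
  (2.3), Def. 2.3, Cor. 2.5; Ch. 6 §6.1 Thm. 1.2.
* L. Grafakos, *Classical Fourier Analysis*, 3rd ed. (2014), Prop. 3.2.6 (4), Prop. 3.2.7 (3).
-/

noncomputable section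

open MeasureTheory TopologicalSpace Set Function Filter UnitAddTorus
open _root_.Topology
open scoped ENNReal NNReal InnerProductSpace ComplexConjugate

namespace Literature.Analysis.FluidPDE

namespace Torus

open Literature.Analysis.FunctionSpaces.Torus Literature.Analysis.FunctionSpaces

variable {d : Type*} [Fintype d]

/-! ## The free term of the forced mild equation -/

section ForcedFreeTerm

variable {T Es κ lam : ℝ} {a : d → ℝ} {θ₀ : UnitAddTorus d → ℝ} {s : ℝ → UnitAddTorus d → ℝ}

/-- The **damped heat family of the datum**, `h(t)(k) = e^{-(νₖ+λ)t} θ̂₀(k)`. [cite: Pazy1983, Ch. 4 §4.2, (2.3) and Def. 2.3 (mild solution), p. 106] -/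
def heatFamily (κ : ℝ) (a : d → ℝ) (lam : ℝ) (θ₀ : UnitAddTorus d → ℝ) (t : ℝ) (k : d → ℤ) : ℂ :=
  ((Real.exp (-((diagRate κ a k + lam) * t)) : ℝ) : ℂ) * mFourierCoeff (fun x => (θ₀ x : ℂ)) k

/-- Unfolding `heatFamily`. [cite: Pazy1983, Ch. 4 §4.2, (2.3) and Def. 2.3 (mild solution), p. 106] -/
theorem heatFamily_apply (κ : ℝ) (a : d → ℝ) (lam : ℝ) (θ₀ : UnitAddTorus d → ℝ) (t : ℝ) (k : d → ℤ) :
    heatFamily κ a lam θ₀ t k =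
      ((Real.exp (-((diagRate κ a k + lam) * t)) : ℝ) : ℂ) * mFourierCoeff (fun x => (θ₀ x : ℂ)) k := rfl

/-- The Picard map of the unforced problem is `heat family - Duhamel coefficient`. [cite: Pazy1983, Ch. 4 §4.2, (2.3) and Def. 2.3 (mild solution), p. 106] -/
theorem mildMap_eq_heatFamily_sub (κ : ℝ) (a : d → ℝ) (lam : ℝ) (u : ℝ → UnitAddTorus d → EuclideanSpace ℝ d)
    (θ₀ : UnitAddTorus d → ℝ) (θ : ℝ → UnitAddTorus d → ℝ) (t : ℝ) (k : d → ℤ) :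
    mildMap κ a lam u θ₀ θ t k = heatFamily κ a lam θ₀ t k - duhamelCoeff κ a lam u θ t k := rfl

/-- **The damped heat family is admissible** with bound `‖θ₀‖_{L²}` on `[0,T]` (`0 < e^{-(νₖ+λ)t} ≤ 1`
for `t ≥ 0`, Bessel, `ν₋ₖ = νₖ`). [cite: Grafakos2014, Prop. 3.2.7 (3)] -/
theorem isMildCoeff_heatFamily (hκ : 0 ≤ κ) (ha : ∀ i, 0 ≤ a i) (hlam : 0 ≤ lam) (hθ₀ : MemLp θ₀ 2 volume)
    (T : ℝ) : IsMildCoeff T (Real.sqrt (∫ x, θ₀ x ^ 2)) (heatFamily κ a lam θ₀) := by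
  refine ⟨fun k => ?_, fun t ht F => ?_, fun t _ k => ?_⟩
  · have h2 : Continuous fun t : ℝ => ((Real.exp (-((diagRate κ a k + lam) * t)) : ℝ) : ℂ) :=
      Complex.continuous_ofReal.comp (Real.continuous_exp.comp ((continuous_const.mul continuous_id).neg))
    exact (h2.mul continuous_const).continuousOn
  · rw [l2F_apply]
    refine Real.sqrt_le_sqrt ((Finset.sum_le_sum fun k _ => ?_).trans
      (sum_le_hasSum F (fun _ _ => sq_nonneg _) (hasSum_sq_norm_mFourierCoeff_ofReal hθ₀)))
    rw [heatFamily_apply, norm_mul, Complex.norm_real, Real.norm_of_nonneg (Real.exp_pos _).le, mul_pow]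
    have h1 : Real.exp (-((diagRate κ a k + lam) * t)) ≤ 1 := by
      rw [Real.exp_le_one_iff, neg_nonpos]
      exact mul_nonneg (add_nonneg (diagRate_nonneg hκ ha k) hlam) ht.1
    calc Real.exp (-((diagRate κ a k + lam) * t)) ^ 2 * ‖mFourierCoeff (fun x => (θ₀ x : ℂ)) k‖ ^ 2
        ≤ 1 ^ 2 * ‖mFourierCoeff (fun x => (θ₀ x : ℂ)) k‖ ^ 2 := by gcongr
      _ = ‖mFourierCoeff (fun x => (θ₀ x : ℂ)) k‖ ^ 2 := by rw [one_pow, one_mul]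
  · rw [heatFamily_apply, heatFamily_apply, map_mul, Complex.conj_ofReal, diagRate_neg, mFourierCoeff_ofReal_comp]

omit [Fintype d] in
/-- Sums of admissible families are admissible (triangle inequality for the finite `ℓ²` norms). [cite: Grafakos2014, Prop. 3.2.7 (3)] -/
theorem IsMildCoeff.add {A B : ℝ} {f g : ℝ → (d → ℤ) → ℂ} (hf : IsMildCoeff T A f) (hg : IsMildCoeff T B g) :
    IsMildCoeff T (A + B) (fun t k => f t k + g t k) := by
  refine ⟨fun k => (hf.continuousOn k).add (hg.continuousOn k), fun t ht F => ?_, fun t ht k => ?_⟩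
  · exact (l2F_add_le F (f t) (g t)).trans (add_le_add (hf.l2F_le t ht F) (hg.l2F_le t ht F))
  · rw [hf.symm t ht k, hg.symm t ht k, map_add]

/-- The **free term of the forced problem** (damped): heat family of the datum plus the damped
source Duhamel term of the attenuated source `e^{-λτ}s(τ)`,
`f(t)(k) = e^{-(νₖ+λ)t} θ̂₀(k) + ∫_{(0,t]} e^{-(νₖ+λ)(t-τ)} e^{-λτ} ŝ(τ)(k) dτ` — the Fourier side of
`e^{-λt}(e^{tA}θ₀ + ∫₀ᵗ e^{(t-τ)A} s(τ) dτ)`, `A = κ∑aᵢ∂ᵢ∂ᵢ` (Pazy 1983, Ch. 4 Cor. 2.5). [cite: Pazy1983, Ch. 4 §4.2, Cor. 2.5 (inhomogeneous problem), p. 107] -/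
def forcedFreeTerm (κ : ℝ) (a : d → ℝ) (lam : ℝ) (s : ℝ → UnitAddTorus d → ℝ) (θ₀ : UnitAddTorus d → ℝ)
    (t : ℝ) (k : d → ℤ) : ℂ :=
  heatFamily κ a lam θ₀ t k + sourceDuhamel κ a lam (fun τ x => Real.exp (-(lam * τ)) * s τ x) t k

/-- Unfolding `forcedFreeTerm`. [cite: Pazy1983, Ch. 4 §4.2, Cor. 2.5 (inhomogeneous problem), p. 107] -/
theorem forcedFreeTerm_apply (κ : ℝ) (a : d → ℝ) (lam : ℝ) (s : ℝ → UnitAddTorus d → ℝ)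
    (θ₀ : UnitAddTorus d → ℝ) (t : ℝ) (k : d → ℤ) :
    forcedFreeTerm κ a lam s θ₀ t k =
      heatFamily κ a lam θ₀ t k + sourceDuhamel κ a lam (fun τ x => Real.exp (-(lam * τ)) * s τ x) t k := rfl

/-- **The free term of the forced problem is admissible** with bound `‖θ₀‖_{L²} + √(E_s/(2λ))`. [cite: Pazy1983, Ch. 4 §4.2, Cor. 2.5 (inhomogeneous problem), p. 107] -/
theorem isMildCoeff_forcedFreeTerm (hκ : 0 ≤ κ) (ha : ∀ i, 0 ≤ a i) (hlam : 0 < lam) (hθ₀ : MemLp θ₀ 2 volume)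
    (hs : SourceL2 T s Es) :
    IsMildCoeff T (Real.sqrt (∫ x, θ₀ x ^ 2) + Real.sqrt (Es / (2 * lam))) (forcedFreeTerm κ a lam s θ₀) :=
  (isMildCoeff_heatFamily hκ ha hlam.le hθ₀ T).add (isMildCoeff_sourceDuhamel (hs.exp_neg_mul hlam.le) hκ ha hlam)

/-- **Undamping the free term**: `e^{λt} f(t)(k) = e^{-νₖt} θ̂₀(k) + S⁰(s)(t)(k)`. [cite: Pazy1983, Ch. 4 §4.2, Cor. 2.5 (inhomogeneous problem), p. 107] -/
theorem exp_mul_forcedFreeTerm (κ : ℝ) (a : d → ℝ) (lam : ℝ) (s : ℝ → UnitAddTorus d → ℝ)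
    (θ₀ : UnitAddTorus d → ℝ) (t : ℝ) (k : d → ℤ) :
    ((Real.exp (lam * t) : ℝ) : ℂ) * forcedFreeTerm κ a lam s θ₀ t k =
      heatFamily κ a 0 θ₀ t k + sourceDuhamel κ a 0 s t k := by
  rw [forcedFreeTerm_apply, mul_add, ← sourceDuhamel_zero_eq_exp_mul, heatFamily_apply, heatFamily_apply,
    ← mul_assoc, ← Complex.ofReal_mul, ← Real.exp_add, add_zero]
  congr 3
  ring

/-- The contraction condition holds for the damping rate `λ = 2(∑ⱼaⱼ⁻¹)U²/κ + 1`. [cite: Pazy1983, Ch. 6 §6.1 Thm. 1.2 (proof: Picard iteration), p. 184] -/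
theorem contraction_const_le (hκ : 0 < κ) (ha : ∀ i, 0 < a i) (U : ℝ) :
    (∑ j, (a j)⁻¹) * U ^ 2 / (2 * κ * (2 * (∑ j, (a j)⁻¹) * U ^ 2 / κ + 1)) ≤ 1 / 4 := by
  set S : ℝ := ∑ j, (a j)⁻¹ with hS'
  have hS : 0 ≤ S := Finset.sum_nonneg fun j _ => inv_nonneg.2 (ha j).le
  have hpos : 0 < 2 * κ * (2 * S * U ^ 2 / κ + 1) := by positivity
  rw [div_le_div_iff₀ hpos (by norm_num : (0 : ℝ) < 4), one_mul]
  have e : 2 * κ * (2 * S * U ^ 2 / κ + 1) = 4 * (S * U ^ 2) + 2 * κ := by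
    field_simp
    ring
  rw [e]
  nlinarith [mul_nonneg hS (sq_nonneg U), hκ.le]

end ForcedFreeTerm

end Torus

end Literature.Analysis.FluidPDE

end
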